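import Summits.QuantumAdvantage.AdviceFreeQNC0.LocalRulesWithFeatures
import Summits.QuantumAdvantage.AdviceFreeQNC0.WalkTransport
import HarnessLib

/-!
# Route RingFrame, crux α `RingToElim` (stmt-QuantumAdvantage-19119): a cycle-HLF device whose
# output bits are LOCAL RULES WITH ORACLE ACCESS TO `n/16` GLOBAL PARITIES of the measurement
# pattern is beaten

Support theorem for the crux item α in the language of the rung leaf `RingHard 2`
(`Literature…RingHLF.Rel`, the graph-state relation of the `(n+1)`-cycle), transported from the
cell's walk-side theorem `ringWinU_localOverParities_le` (`LocalRulesWithFeatures.lean`: the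
K-feature window theorem at the Viola–Wigderson budget, `LowDegFeatureWindow.lean`) through the
affine chart of `WalkTransport.lean` (`rel_iff_ringWinU`, `xOfU`, `hasDeg_transport`):

* `ringRel_localOverParities_le`: there is `θ < 1` such that for every `C`, all large `n`, every
  `K` with `16·(K+3) ≤ n`, every `K` AFFINE Boolean functions `ℓ_1, …, ℓ_K` of the measurement
  pattern `x ∈ {0,1}^{n+1}`, and every tuple `P` of `𝔽₂`-polynomials of degree `≤ (log₂ (n+1))^C`
  each of whose output bits `[P_i(x) = 1]` is a function of the pattern bits in the window
  `[i − (log₂(n+1))^C, i + (log₂(n+1))^C)` and of `ℓ_1(x), …, ℓ_K(x)` (arbitrary combiner): the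
  relation `Rel x (P x)` holds for at most `θ·2^{n+1}` patterns `x`.

So a classical polylog-degree device for the cycle problem gains nothing from oracle access to a
LINEAR number (`n/16 − 3`) of global parities on top of polylog-local processing — the
advice-free constant-depth quantum circuit (`hlf_quantum_constant_depth_holds`) solves every
instance.  In walk coordinates the window is `x = [0, n/2)`, gap `(log₂ n)^{C'}`, block
`(log₂ n)^{2C'+1}`, `C' = 2C + 2`; the chart `xOfU` is affine and `2`-local, and the canonical
guess `tGuess` is `2`-local away from the base point, so locality and affinity transport.

The cell's statement (prover qn-prover-3 gen 5; a special case of crux α of route RingFrame);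
not in print.  WHAT THIS IS NOT: not `RingHard 2` / α — devices whose outputs read the far side
through polylog-degree or block-coupling features are untouched; no separation claim.
-/

-- the sub-problem namespace `Summit.QuantumAdvantage.QuantumAdvantage` repeats the summit name by design (D-0017)
set_option linter.dupNamespace false

noncomputable section

namespace Summit.QuantumAdvantage.QuantumAdvantage.Theorems

open Finset Summit.QuantumAdvantage.AdviceFreeQNC0
open Literature.Computability.QuantumComplexity Literature.Computability.QuantumComplexity.RingHLF
open Literature.Computability.MetaComplexity Literature.Computability.MetaComplexity.Smolensky

/-! ### Locality of the chart -/

/-- `uExt` agrees on an index where the two walk inputs agree (or beyond the end). -/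
private theorem uExt_congr {n : ℕ} {u u' : Fin n → Bool} {i : ℕ}
    (h : ∀ hi : i < n, u ⟨i, hi⟩ = u' ⟨i, hi⟩) : uExt u i = uExt u' i := by
  unfold uExt
  by_cases hi : i < n
  · rw [dif_pos hi, dif_pos hi, h hi]
  · rw [dif_neg hi, dif_neg hi]

/-- **The chart is `2`-local**: `xOfU u j` depends only on `u_j` and `u_{j−1}`. -/
private theorem xOfU_congr {n : ℕ} {u u' : Fin n → Bool} (j : Fin (n + 1))
    (h : ∀ i : Fin n, (i.val = j.val ∨ i.val + 1 = j.val) → u i = u' i) : xOfU u j = xOfU u' j := by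
  unfold xOfU
  rw [uExt_congr (i := j.val) (fun hi => h ⟨j.val, hi⟩ (Or.inl rfl))]
  by_cases hj0 : j.val = 0
  · rw [if_pos hj0, if_pos hj0]
  · rw [if_neg hj0, if_neg hj0, uExt_congr (i := j.val - 1) (fun hi => h ⟨j.val - 1, hi⟩ (Or.inr (by
      show j.val - 1 + 1 = j.val; omega)))]

/-- Degree bookkeeping of the transport (as in `WalkTransport.lean`): `(log₂ (n+1))^c ≤
(log₂ n)^(2c+1)` and `1 ≤ (log₂ n)^(2c+1)` for `n ≥ 4`. [folklore] -/
private theorem transport_degree_le₆ {n : ℕ} (hn : 4 ≤ n) (c : ℕ) :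
    (Nat.log 2 (n + 1)) ^ c ≤ (Nat.log 2 n) ^ (2 * c + 1) ∧ 1 ≤ (Nat.log 2 n) ^ (2 * c + 1) := by
  have hlog : 2 ≤ Nat.log 2 n := Nat.le_log_of_pow_le (by norm_num) (by omega)
  have hsucc : Nat.log 2 (n + 1) ≤ Nat.log 2 n + 1 := by
    have h : n + 1 ≤ 2 ^ (Nat.log 2 n + 1) := Nat.lt_pow_succ_log_self (by norm_num) n
    calc Nat.log 2 (n + 1) ≤ Nat.log 2 (2 ^ (Nat.log 2 n + 1)) := Nat.log_mono_right h
      _ = Nat.log 2 n + 1 := Nat.log_pow (by norm_num) _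
  have h1 : Nat.log 2 (n + 1) ≤ Nat.log 2 n * Nat.log 2 n := by nlinarith
  constructor
  · calc (Nat.log 2 (n + 1)) ^ c ≤ (Nat.log 2 n * Nat.log 2 n) ^ c := Nat.pow_le_pow_left h1 c
      _ = (Nat.log 2 n) ^ (2 * c) := by rw [← pow_two, ← pow_mul]
      _ ≤ (Nat.log 2 n) ^ (2 * c + 1) := Nat.pow_le_pow_right (by omega) (by omega)
  · exact Nat.one_le_pow _ _ (by omega)

/-- Room: `4·(log₂ n)^{2C+1} ≤ n` for all large `n`. -/
private theorem four_mul_logPow_le₆ (C : ℕ) : ∃ n₀ : ℕ, ∀ n ≥ n₀, 4 * (Nat.log 2 n) ^ (2 * C + 1) ≤ n := by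
  obtain ⟨n₂, hn₂⟩ := logPow_le_sqrt' (2 * C + 1) (c₀ := 1 / 4) (by norm_num)
  refine ⟨max n₂ 2, fun n hn => ?_⟩
  have hn₂n : n₂ ≤ n := le_trans (le_max_left _ _) hn
  have hn2 : 2 ≤ n := le_trans (le_max_right _ _) hn
  have h1 : (((Nat.log 2 n) ^ (2 * C + 1) : ℕ) : ℝ) ≤ 1 / 4 * Real.sqrt n := hn₂ n hn₂n
  have h2 : Real.sqrt n ≤ n := by
    have hn1 : (1 : ℝ) ≤ n := by exact_mod_cast (le_trans (by norm_num) hn2)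
    calc Real.sqrt n ≤ Real.sqrt n * Real.sqrt n :=
          le_mul_of_one_le_right (Real.sqrt_nonneg _) (by rw [← Real.sqrt_one]; exact Real.sqrt_le_sqrt hn1)
      _ = n := Real.mul_self_sqrt (by positivity)
  have h3 : ((4 * (Nat.log 2 n) ^ (2 * C + 1) : ℕ) : ℝ) ≤ n := by push_cast at h1 ⊢; linarith
  exact_mod_cast h3

/-! ### The theorem -/

/-- **A cycle-HLF device whose outputs are local rules with oracle access to `n/16` global
parities is beaten.**  There is `θ < 1` such that for every `C`, all large `n`, every `K` with
`16·(K+3) ≤ n`, every `K` affine Boolean functions `ℓ_k` of the pattern, and every tuple `P` of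
`𝔽₂`-polynomials on `{0,1}^{n+1}` of degree `≤ (log₂ (n+1))^C` each of whose output bits
`[P_i(x) = 1]` is a function of the pattern bits `x_j`, `i − (log₂(n+1))^C ≤ j < i + (log₂(n+1))^C`,
and of `ℓ_1(x), …, ℓ_K(x)`: `Rel x (P x)` holds for at most `θ·2^{n+1}` measurement patterns `x`.
[cite: ViolaWigderson2008, Theorem 2.9; Srinivasan2023, Lemma 3.1] -/
theorem ringRel_localOverParities_le :
    ∃ θ : ℝ, θ < 1 ∧ ∀ C : ℕ, ∃ n₀ : ℕ, ∀ n ≥ n₀, ∀ K : ℕ, 16 * (K + 3) ≤ n →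
      ∀ ℓ : Fin K → (Fin (n + 1) → Bool) → Bool, (∀ k, HasDeg (ℓ k) 1) →
      ∀ P : Fin (n + 1) → CubeFn (ZMod 2) (n + 1),
        (∀ i, P i ∈ lowDeg (ZMod 2) (n + 1) ((Nat.log 2 (n + 1)) ^ C)) →
        (∀ i : Fin (n + 1), ∃ G : (Fin (n + 1) → Bool) → (Fin K → Bool) → Bool,
          (∀ (x x' : Fin (n + 1) → Bool) (v : Fin K → Bool),
            (∀ j : Fin (n + 1), i.val ≤ j.val + (Nat.log 2 (n + 1)) ^ C →
              j.val < i.val + (Nat.log 2 (n + 1)) ^ C → x j = x' j) → G x v = G x' v) ∧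
          ∀ x, decide (P i x = 1) = G x (fun k => ℓ k x)) →
          ((univ.filter fun x : Fin (n + 1) → Bool =>
              Rel x (fun i => decide (P i x = 1))).card : ℝ) ≤ θ * (2 : ℝ) ^ (n + 1) := by
  classical
  obtain ⟨θ', hθ', hW⟩ := ringWinU_localOverParities_le
  refine ⟨(1 + θ') / 2, by linarith, fun C => ?_⟩
  obtain ⟨n₁, hn₁⟩ := hW (2 * C + 2)
  obtain ⟨n₂, hn₂⟩ := four_mul_logPow_le₆ (2 * C + 2)
  refine ⟨max n₁ (max n₂ 4), fun n hn K hK ℓ hℓ P hP hloc => ?_⟩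
  have hn₁n : n₁ ≤ n := le_trans (le_max_left _ _) hn
  have hn₂n : n₂ ≤ n := le_trans (le_trans (le_max_left _ _) (le_max_right _ _)) hn
  have hn4 : 4 ≤ n := le_trans (le_trans (le_max_right _ _) (le_max_right _ _)) hn
  have hk2 : 2 ≤ Nat.log 2 n := Nat.le_log_of_pow_le one_lt_two (by simpa using hn4)
  -- degrees and ranges: `r = (log₂ (n+1))^C ≤ (log₂ n)^{2C+1}`, `(log₂ n)^{2C+1} + 1 ≤ (log₂ n)^{2C+2}`
  obtain ⟨hdegle, hone⟩ := transport_degree_le₆ hn4 C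
  have hr1 : 1 ≤ (Nat.log 2 (n + 1)) ^ C :=
    Nat.one_le_pow _ _ (Nat.log_pos one_lt_two (by omega))
  have hpow : (Nat.log 2 n) ^ (2 * C + 1) + 1 ≤ (Nat.log 2 n) ^ (2 * C + 2) := by
    have h2 : (Nat.log 2 n) ^ (2 * C + 2) = (Nat.log 2 n) ^ (2 * C + 1) * Nat.log 2 n :=
      pow_succ _ _
    rw [h2]
    nlinarith
  have hr : (Nat.log 2 (n + 1)) ^ C + 1 ≤ (Nat.log 2 n) ^ (2 * C + 2) :=
    le_trans (Nat.add_le_add_right hdegle 1) hpow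
  -- the transported walk strategy and its degree
  set z : (Fin (n + 1) → Bool) → (Fin (n + 1) → Bool) := fun x i => decide (P i x = 1) with hz
  set y : Fin (n + 1) → (Fin n → Bool) → Bool :=
    fun g u => xor (z (xOfU u) g) (tGuess (xOfU u) g) with hy
  have hdeg : ∀ g, HasDeg (y g) ((Nat.log 2 n) ^ (2 * C + 2)) := fun g =>
    hasDeg_of_le (hasDeg_transport hone (P g) (lowDeg_mono hdegle (hP g)) g) (by omega)
  -- the transported parities are affine in `u`
  set ℓ' : Fin K → (Fin n → Bool) → Bool := fun kk u => ℓ kk (xOfU u) with hℓ'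
  have hℓ'deg : ∀ kk, HasDeg (ℓ' kk) 1 := fun kk =>
    AdviceFreeQNC0.comp_mem_lowDeg_of_coord xOfU ind_xOfU_mem (hℓ kk)
  -- the window `x = [0, n/2)`, gap `(log₂ n)^{2C+2}`, block `(log₂ n)^{2(2C+2)+1}`
  have hroom : 4 * (Nat.log 2 n) ^ (2 * (2 * C + 2) + 1) ≤ n := hn₂ n hn₂n
  have hkC : (Nat.log 2 n) ^ (2 * C + 2) ≤ (Nat.log 2 n) ^ (2 * (2 * C + 2) + 1) :=
    Nat.pow_le_pow_right (by omega) (by omega)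
  have hfit : 0 + (n / 2 + (Nat.log 2 n) ^ (2 * C + 2) + (Nat.log 2 n) ^ (2 * (2 * C + 2) + 1)) ≤ n := by
    omega
  have hKL : 8 * (K + 3) ≤ n / 2 := by omega
  -- the interior cuts of the block are local rules over the transported parities
  have hwin := hn₁ n hn₁n 0 (n / 2) ((Nat.log 2 n) ^ (2 * C + 2)) ((Nat.log 2 n) ^ (2 * (2 * C + 2) + 1))
    K hfit le_rfl le_rfl hKL (n + 2) ℓ' hℓ'deg y hdeg (fun g hg1 hg2 => by
      obtain ⟨G, hG, hPG⟩ := hloc g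
      have hgn : g.val + 1 < n + 1 := by omega
      refine ⟨fun u v => xor (G (xOfU u) v) (tGuess (xOfU u) g), fun u u' v huu' => ?_, fun u => ?_⟩
      · -- locality in `u`: the chart is `2`-local and the window has room
        have hx : ∀ j : Fin (n + 1), g.val ≤ j.val + (Nat.log 2 (n + 1)) ^ C →
            j.val ≤ g.val + (Nat.log 2 (n + 1)) ^ C → xOfU u j = xOfU u' j := by
          intro j hj1 hj2
          refine xOfU_congr j fun i hi => huu' i ?_ ?_
          · rcases hi with hi | hi <;> omega
          · rcases hi with hi | hi <;> omega
        have hG' : G (xOfU u) v = G (xOfU u') v :=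
          hG _ _ v fun j hj1 hj2 => hx j (by omega) (by omega)
        have hg0 : xOfU u g = xOfU u' g := hx g (by omega) (by omega)
        have hnxt : (nxt g).val = g.val + 1 := by
          show (g.val + 1) % (n + 1) = g.val + 1
          exact Nat.mod_eq_of_lt hgn
        have hg1' : xOfU u (nxt g) = xOfU u' (nxt g) := hx (nxt g) (by omega) (by omega)
        show xor (G (xOfU u) v) (tGuess (xOfU u) g) = xor (G (xOfU u') v) (tGuess (xOfU u') g)
        unfold tGuess
        rw [hG', hg0, hg1']
      · show xor (z (xOfU u) g) (tGuess (xOfU u) g) =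
          xor (G (xOfU u) fun kk => ℓ' kk u) (tGuess (xOfU u) g)
        rw [show z (xOfU u) g = decide (P g (xOfU u) = 1) from rfl, hPG])
  -- split the solved patterns by the parity of the number of zeros
  set Sx := univ.filter fun x : Fin (n + 1) → Bool => Rel x (z x) with hSx
  set OddZ : (Fin (n + 1) → Bool) → Prop := fun x =>
    (univ.filter fun j : Fin (n + 1) => x j = false).card % 2 = 1 with hOddZ
  have hsplit : Sx.card = (Sx.filter OddZ).card + (Sx.filter fun x => ¬ OddZ x).card :=
    (Finset.card_filter_add_card_filter_not _).symm
  have heven : (Sx.filter fun x => ¬ OddZ x).card ≤ 2 ^ n := by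
    refine le_trans (Finset.card_le_card ?_) card_even_class_le
    intro x hx
    rw [mem_filter] at hx ⊢
    exact ⟨mem_univ _, hx.2⟩
  have hodd : (Sx.filter OddZ).card ≤
      (univ.filter fun u : Fin n → Bool => ringWinU (n + 2) y u = true).card := by
    refine Finset.card_le_card_of_injOn uVec ?_ ?_
    · intro x hx
      rw [Finset.mem_coe, mem_filter, hSx, mem_filter] at hx
      rw [Finset.mem_coe, mem_filter]
      exact ⟨mem_univ _, (rel_iff_ringWinU (by omega) x hx.2 z).1 hx.1.2⟩
    · intro x₁ hx₁ x₂ hx₂ h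
      rw [Finset.mem_coe, mem_filter] at hx₁ hx₂
      rw [← xOfU_uVec (by omega) x₁ hx₁.2, ← xOfU_uVec (by omega) x₂ hx₂.2, h]
  -- arithmetic
  have hS : (Sx.card : ℝ) ≤ 2 ^ n + θ' * 2 ^ n := by
    have h1 : (Sx.card : ℝ) ≤
        ((Sx.filter fun x => ¬ OddZ x).card : ℝ) + ((Sx.filter OddZ).card : ℝ) := by
      rw [hsplit]; push_cast; linarith
    have h2 : ((Sx.filter fun x => ¬ OddZ x).card : ℝ) ≤ 2 ^ n := by exact_mod_cast heven
    have h3 : ((Sx.filter OddZ).card : ℝ) ≤ θ' * 2 ^ n :=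
      le_trans (by exact_mod_cast hodd) hwin
    linarith
  have hpow2 : (2 : ℝ) ^ (n + 1) = 2 * 2 ^ n := by ring
  calc (Sx.card : ℝ) ≤ 2 ^ n + θ' * 2 ^ n := hS
    _ = (1 + θ') / 2 * (2 : ℝ) ^ (n + 1) := by rw [hpow2]; ring

end Summit.QuantumAdvantage.QuantumAdvantage.Theorems

end
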